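import Literature.Computability.ImplicitComplexity.STATokens
import Literature.Computability.Complexity.CodeFPArith
import HarnessLib

/-!
# Token codes as bit strings: the span scan and the redex search in polynomial time

Support file for the `PTIME` soundness half of `STACapturesP` (GMR08 Thm. 3.5: "every
β-reduction step can be carried out on a Turing machine in a number of steps polynomial in the
size of the term"). The list programs of `STATokens.lean` are realised as polynomial-time string
functions through the typed `FP` combinators of `CodeFP.lean` (`CodeFP eα eβ g`: the map `g` is
computed on codes by an `FP` string function):

* `tokE` — the bit code of a token (a pair of binary numerals: tag, variable index), injective;
  the token primitives (`codeFP_tokParts`, `codeFP_arity`, `codeFP_isL`, `codeFP_isA`, `codeFP_V`);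
* `codeFP_spanTerm` — `spanTerm` on raw lists of token codes (a left fold whose state stays
  linear in the input, `length_spanState_le`);
* `codeFP_splitRedex` — `splitRedex` likewise.

Shifting, substitution and the whole step follow in the sequel.

## References

* [GaboardiMarionRonchidellarocca2008] GMR08, Thm. 3.5.
* S. Arora, B. Barak, Computational Complexity: A Modern Approach, CUP 2009, §1.3 (closure of
  polynomial time under composition and polynomially bounded loops) [AroraBarak2009].
-/

namespace Literature.Computability.ImplicitComplexity

namespace STA

open Literature.Computability.Complexity Literature.Computability.Complexity.CodeFP Polynomial

/-! ### The bit code of tokens -/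

/-- Tag of a token: `V ↦ 0`, `L ↦ 1`, `A ↦ 2`, `S ↦ 3`. [folklore] -/
def Tok.tag : Tok → ℕ
  | .V _ => 0
  | .L => 1
  | .A => 2
  | .S => 3

/-- Variable index of a token (`0` for non-variables). [folklore] -/
def Tok.idx : Tok → ℕ
  | .V i => i
  | _ => 0

/-- A token from its parts. [folklore] -/
def Tok.ofParts (p : ℕ × ℕ) : Tok :=
  if p.1 = 0 then .V p.2 else if p.1 = 1 then .L else if p.1 = 2 then .A else .S

/-- Parts determine the token. [folklore] -/
theorem Tok.ofParts_parts (t : Tok) : Tok.ofParts (t.tag, t.idx) = t := by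
  cases t <;> simp [Tok.ofParts, Tok.tag, Tok.idx]

/-- The arity is the tag capped at `2`. [folklore] -/
theorem Tok.arity_eq_min (t : Tok) : t.arity = min t.tag 2 := by
  cases t <;> simp [Tok.arity, Tok.tag]

/-- **The bit code of a token**: the pair code of (tag, index). [folklore] -/
def tokE : Tok → List Bool := fun t => pairE natE natE (t.tag, t.idx)

/-- `tokE` is injective. [folklore] -/
theorem tokE_injective : Function.Injective tokE := fun t t' h => by
  have h1 := pairE_injective natE_injective natE_injective h
  rw [← Tok.ofParts_parts t, ← Tok.ofParts_parts t', h1]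

/-- Length of a token code: at most `idx + 8`. [folklore] -/
theorem length_tokE_le (t : Tok) : (tokE t).length ≤ t.idx + 8 := by
  have h1 : (natE t.tag).length ≤ 3 := (length_natE_le _).trans (by cases t <;> simp [Tok.tag])
  have h2 := length_natE_le t.idx
  simp only [tokE, pairE_apply, length_boolPair]
  omega

/-- The parts of a token are read off its code by the identity. [folklore] -/
theorem codeFP_tokParts : CodeFP tokE (pairE natE natE) (fun t => (t.tag, t.idx)) :=
  of_fn _root_.id (Literature.Computability.Complexity.PolyTimeComputable.id _) fun _ => rfl

/-- The tag of a token. [folklore] -/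
theorem codeFP_tag : CodeFP tokE natE Tok.tag := (fst natE natE).comp codeFP_tokParts

/-- The index of a token. [folklore] -/
theorem codeFP_idx : CodeFP tokE natE Tok.idx := (snd natE natE).comp codeFP_tokParts

/-- The arity of a token. [folklore] -/
theorem codeFP_arity : CodeFP tokE natE Tok.arity :=
  (natMin.comp (codeFP_tag.pair (const tokE 2))).congr fun t => (Tok.arity_eq_min t).symm

/-- A token with a given tag (test). [folklore] -/
theorem codeFP_tagEq (n : ℕ) : CodeFP tokE bitE (fun t => decide (t.tag = n)) :=
  natEq.comp (codeFP_tag.pair (const tokE n))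

/-- "Is the token `L`?" [folklore] -/
theorem codeFP_isL : CodeFP tokE bitE (fun t => decide (t = .L)) :=
  (codeFP_tagEq 1).congr fun t => by cases t <;> simp [Tok.tag]

/-- "Is the token `A`?" [folklore] -/
theorem codeFP_isA : CodeFP tokE bitE (fun t => decide (t = .A)) :=
  (codeFP_tagEq 2).congr fun t => by cases t <;> simp [Tok.tag]

/-- Building a variable token. [folklore] -/
theorem codeFP_V : CodeFP natE tokE Tok.V :=
  ((const natE 0).pair (CodeFP.id natE)).recodeOut fun _ => rfl

/-! ### Code lengths of token lists -/

/-- A raw token list code is at least as long as the list. [folklore] -/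
theorem length_le_rawE_tok (l : List Tok) : l.length ≤ (rawE tokE l).length := length_le_length_rawE _ _

/-- Raw codes add up along concatenation. [folklore] -/
theorem length_rawE_append (l₁ l₂ : List Tok) :
    (rawE tokE (l₁ ++ l₂)).length = (rawE tokE l₁).length + (rawE tokE l₂).length := by
  rw [rawE_append, List.length_append]

/-- Raw code of a singleton. [folklore] -/
theorem length_rawE_singleton (t : Tok) : (rawE tokE [t]).length = 2 * (tokE t).length + 2 := by
  simp [rawE, encList, length_boolPair]

/-! ### The span scan -/

/-- Code of the span state `(need, taken, rest)`. [folklore] -/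
def spanE : ℕ × List Tok × List Tok → List Bool := pairE natE (pairE (rawE tokE) (rawE tokE))

/-- One span step is computed on codes. [folklore] -/
theorem codeFP_spanStep : CodeFP (pairE tokE spanE) spanE (fun p => spanStep p.2 p.1) := by
  have htok : CodeFP (pairE tokE spanE) tokE (fun p => p.1) := fst _ _
  have hneed : CodeFP (pairE tokE spanE) natE (fun p => p.2.1) := (snd _ _).fst'
  have htaken : CodeFP (pairE tokE spanE) (rawE tokE) (fun p => p.2.2.1) := (snd _ _).snd'.fst'
  have hrest : CodeFP (pairE tokE spanE) (rawE tokE) (fun p => p.2.2.2) := (snd _ _).snd'.snd'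
  have hsing : CodeFP (pairE tokE spanE) (rawE tokE) (fun p => [p.1]) := (rawSingleton tokE).comp htok
  have hz : CodeFP (pairE tokE spanE) bitE (fun p => decide (p.2.1 = 0)) :=
    natEq.comp (hneed.pair (const _ 0))
  have hb1 : CodeFP (pairE tokE spanE) spanE (fun p => (0, p.2.2.1, p.2.2.2 ++ [p.1])) :=
    (const _ 0).pair (htaken.pair ((rawAppend tokE).comp (hrest.pair hsing)))
  have hb2 : CodeFP (pairE tokE spanE) spanE
      (fun p => (p.2.1 - 1 + p.1.arity, p.2.2.1 ++ [p.1], p.2.2.2)) :=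
    (natAdd.comp ((natSub.comp (hneed.pair (const _ 1))).pair (codeFP_arity.comp htok))).pair
      (((rawAppend tokE).comp (htaken.pair hsing)).pair hrest)
  refine (ite hz hb1 hb2).congr fun p => ?_
  obtain ⟨t, n, a, r⟩ := p
  by_cases h : n = 0 <;> simp [spanStep, h]

/-- The potential of the span scan: the codes of `taken` and `rest` together. [folklore] -/
theorem span_foldl_inv (xs : List Tok) (n : ℕ) (a r : List Tok) :
    (rawE tokE (xs.foldl spanStep (n, a, r)).2.1).length + (rawE tokE (xs.foldl spanStep (n, a, r)).2.2).length =
      (rawE tokE a).length + (rawE tokE r).length + (rawE tokE xs).length ∧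
    (xs.foldl spanStep (n, a, r)).1 ≤ n + xs.length := by
  induction xs generalizing n a r with
  | nil => simp
  | cons t xs ih =>
    rw [List.foldl_cons]
    have harity : t.arity ≤ 2 := by cases t <;> simp [Tok.arity]
    by_cases h : n = 0
    · subst h
      have hs : spanStep (0, a, r) t = (0, a, r ++ [t]) := by simp [spanStep]
      rw [hs]
      obtain ⟨h1, h2⟩ := ih 0 a (r ++ [t])
      refine ⟨?_, h2.trans (by simp)⟩
      rw [h1, length_rawE_append, show rawE tokE (t :: xs) = rawE tokE ([t] ++ xs) from rfl,
        length_rawE_append]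
      omega
    · have hs : spanStep (n, a, r) t = (n - 1 + t.arity, a ++ [t], r) := by simp [spanStep, h]
      rw [hs]
      obtain ⟨h1, h2⟩ := ih (n - 1 + t.arity) (a ++ [t]) r
      refine ⟨?_, ?_⟩
      · rw [h1, length_rawE_append, show rawE tokE (t :: xs) = rawE tokE ([t] ++ xs) from rfl,
          length_rawE_append]
        omega
      · simp only [List.length_cons]
        omega

/-- **The span state stays linear in the input.** [folklore] -/
theorem length_spanState_le (l₁ l₂ : List Tok) :
    (spanE (l₁.foldl spanStep (1, [], []))).length ≤ 6 * (rawE tokE (l₁ ++ l₂)).length + 6 := by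
  obtain ⟨h1, h2⟩ := span_foldl_inv l₁ 1 [] []
  set st := l₁.foldl spanStep (1, [], [])
  have hneed : (natE st.1).length ≤ 1 + l₁.length := (length_natE_le _).trans h2
  have hl := length_le_rawE_tok l₁
  have hmono : (rawE tokE l₁).length ≤ (rawE tokE (l₁ ++ l₂)).length := by
    rw [length_rawE_append]; omega
  simp only [spanE, pairE_apply, length_boolPair]
  simp only [rawE_nil, List.length_nil, Nat.zero_add] at h1
  omega

/-- **`spanTerm` is computed on codes.** [folklore] -/
theorem codeFP_spanTerm : CodeFP (rawE tokE) (pairE (rawE tokE) (rawE tokE)) spanTerm := by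
  have hf : CodeFP (rawE tokE) spanE (fun l => l.foldl (fun st t => spanStep st t) (1, [], [])) :=
    foldl₀ (step := fun t st => spanStep st t) (b₀ := (1, [], [])) codeFP_spanStep (6 * X + 6)
      fun l₁ l₂ => by simpa using length_spanState_le l₁ l₂
  exact ((snd natE _).comp hf).congr fun l => rfl

/-! ### The redex search -/

/-- Code of the search state `(before, pendingA, found, after)`. [folklore] -/
def splitE : List Tok × Bool × Bool × List Tok → List Bool :=
  pairE (rawE tokE) (pairE bitE (pairE bitE (rawE tokE)))

/-- One search step is computed on codes. [folklore] -/
theorem codeFP_splitStep : CodeFP (pairE tokE splitE) splitE (fun p => splitStep p.2 p.1) := by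
  have htok : CodeFP (pairE tokE splitE) tokE (fun p => p.1) := fst _ _
  have hbef : CodeFP (pairE tokE splitE) (rawE tokE) (fun p => p.2.1) := (snd _ _).fst'
  have hpend : CodeFP (pairE tokE splitE) bitE (fun p => p.2.2.1) := (snd _ _).snd'.fst'
  have hfound : CodeFP (pairE tokE splitE) bitE (fun p => p.2.2.2.1) := (snd _ _).snd'.snd'.fst'
  have haft : CodeFP (pairE tokE splitE) (rawE tokE) (fun p => p.2.2.2.2) := (snd _ _).snd'.snd'.snd'
  have hsing : CodeFP (pairE tokE splitE) (rawE tokE) (fun p => [p.1]) := (rawSingleton tokE).comp htok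
  have hisL : CodeFP (pairE tokE splitE) bitE (fun p => decide (p.1 = .L)) := codeFP_isL.comp htok
  have hisA : CodeFP (pairE tokE splitE) bitE (fun p => decide (p.1 = .A)) := codeFP_isA.comp htok
  have hT : CodeFP (pairE tokE splitE) bitE (fun _ => true) := const _ true
  have hF : CodeFP (pairE tokE splitE) bitE (fun _ => false) := const _ false
  have hA : CodeFP (pairE tokE splitE) (rawE tokE) (fun _ => [Tok.A]) := const _ [Tok.A]
  -- the five outcomes
  have o1 : CodeFP (pairE tokE splitE) splitE (fun p => (p.2.1, p.2.2.1, true, p.2.2.2.2 ++ [p.1])) :=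
    hbef.pair (hpend.pair (hT.pair ((rawAppend tokE).comp (haft.pair hsing))))
  have o2 : CodeFP (pairE tokE splitE) splitE (fun p => (p.2.1, false, true, p.2.2.2.2)) :=
    hbef.pair (hF.pair (hT.pair haft))
  have o3 : CodeFP (pairE tokE splitE) splitE (fun p => (p.2.1 ++ [Tok.A], true, false, p.2.2.2.2)) :=
    ((rawAppend tokE).comp (hbef.pair hA)).pair (hT.pair (hF.pair haft))
  have o4 : CodeFP (pairE tokE splitE) splitE (fun p => (p.2.1 ++ ([Tok.A] ++ [p.1]), false, false, p.2.2.2.2)) :=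
    ((rawAppend tokE).comp (hbef.pair ((rawAppend tokE).comp (hA.pair hsing)))).pair (hF.pair (hF.pair haft))
  have o5 : CodeFP (pairE tokE splitE) splitE (fun p => (p.2.1, true, false, p.2.2.2.2)) :=
    hbef.pair (hT.pair (hF.pair haft))
  have o6 : CodeFP (pairE tokE splitE) splitE (fun p => (p.2.1 ++ [p.1], false, false, p.2.2.2.2)) :=
    ((rawAppend tokE).comp (hbef.pair hsing)).pair (hF.pair (hF.pair haft))
  refine ((ite hfound o1 (ite hpend (ite hisL o2 (ite hisA o3 o4)) (ite hisA o5 o6))).congr fun p => ?_)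
  obtain ⟨t, bef, pend, found, aft⟩ := p
  simp only [splitStep]
  cases found
  · cases pend
    · by_cases hA' : t = Tok.A <;> simp [hA']
    · by_cases hL' : t = Tok.L
      · subst hL'; simp
      · by_cases hA' : t = Tok.A <;> simp [hL', hA']
  · simp

/-- The potential of the search: the codes of `before` and `after`, plus the debt of a pending
`A`. [folklore] -/
def splitPot (st : List Tok × Bool × Bool × List Tok) : ℕ :=
  (rawE tokE st.1).length + (rawE tokE st.2.2.2).length +
    (if st.2.1 && !st.2.2.1 then (rawE tokE [Tok.A]).length else 0)

/-- Each search step raises the potential by at most the code of the token read. [folklore] -/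
theorem splitPot_splitStep_le (st : List Tok × Bool × Bool × List Tok) (t : Tok) :
    splitPot (splitStep st t) ≤ splitPot st + (rawE tokE [t]).length := by
  obtain ⟨bef, pend, found, aft⟩ := st
  have happ : ∀ l₁ l₂ : List Tok, (rawE tokE (l₁ ++ l₂)).length = (rawE tokE l₁).length + (rawE tokE l₂).length :=
    length_rawE_append
  simp only [splitStep, splitPot]
  cases found
  · cases pend
    · by_cases hA' : t = Tok.A
      · subst hA'; simp
      · simp [hA', happ]; omega
    · by_cases hL' : t = Tok.L
      · subst hL'; simp; omega
      · by_cases hA' : t = Tok.A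
        · subst hA'; simp [happ]; omega
        · simp only [hL', hA', if_false, Bool.true_and, Bool.not_false, if_true, Bool.false_and,
            Bool.false_eq_true, Nat.add_zero]
          rw [show bef ++ [Tok.A, t] = bef ++ [Tok.A] ++ [t] from by simp, happ, happ]
          omega
  · simp [happ]; omega

/-- The potential along the search. [folklore] -/
theorem splitPot_foldl_le (xs : List Tok) (st : List Tok × Bool × Bool × List Tok) :
    splitPot (xs.foldl splitStep st) ≤ splitPot st + (rawE tokE xs).length := by
  induction xs generalizing st with
  | nil => simp
  | cons t xs ih =>
    rw [List.foldl_cons]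
    refine (ih _).trans ?_
    have := splitPot_splitStep_le st t
    rw [show t :: xs = [t] ++ xs from rfl, length_rawE_append]
    omega

/-- **The search state stays linear in the input.** [folklore] -/
theorem length_splitState_le (l₁ l₂ : List Tok) :
    (splitE (l₁.foldl splitStep ([], false, false, []))).length ≤ 2 * (rawE tokE (l₁ ++ l₂)).length + 40 := by
  have h := splitPot_foldl_le l₁ ([], false, false, [])
  set st := l₁.foldl splitStep ([], false, false, [])
  have h0 : splitPot ([], false, false, []) = 0 := by simp [splitPot]
  have hbef : (rawE tokE st.1).length + (rawE tokE st.2.2.2).length ≤ splitPot st := by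
    simp only [splitPot]; omega
  have hmono : (rawE tokE l₁).length ≤ (rawE tokE (l₁ ++ l₂)).length := by
    rw [length_rawE_append]; omega
  simp only [splitE, pairE_apply, length_boolPair, bitE, List.length_singleton]
  omega

/-- **`splitRedex` is computed on codes.** [folklore] -/
theorem codeFP_splitRedex : CodeFP (rawE tokE) (pairE bitE (pairE (rawE tokE) (rawE tokE))) splitRedex := by
  have hf : CodeFP (rawE tokE) splitE (fun l => l.foldl (fun st t => splitStep st t) ([], false, false, [])) :=
    foldl₀ (step := fun t st => splitStep st t) (b₀ := ([], false, false, [])) codeFP_splitStep (2 * X + 40)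
      fun l₁ l₂ => by simpa using length_splitState_le l₁ l₂
  have hbef : CodeFP (rawE tokE) (rawE tokE) (fun l => (l.foldl (fun st t => splitStep st t) ([], false, false, [])).1) :=
    hf.fst'
  have hpend : CodeFP (rawE tokE) bitE (fun l => (l.foldl (fun st t => splitStep st t) ([], false, false, [])).2.1) :=
    hf.snd'.fst'
  have hfound : CodeFP (rawE tokE) bitE (fun l => (l.foldl (fun st t => splitStep st t) ([], false, false, [])).2.2.1) :=
    hf.snd'.snd'.fst'
  have haft : CodeFP (rawE tokE) (rawE tokE) (fun l => (l.foldl (fun st t => splitStep st t) ([], false, false, [])).2.2.2) :=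
    hf.snd'.snd'.snd'
  have hflush : CodeFP (rawE tokE) (rawE tokE) (fun l =>
      (l.foldl (fun st t => splitStep st t) ([], false, false, [])).1 ++
        (if (l.foldl (fun st t => splitStep st t) ([], false, false, [])).2.1 &&
            !(l.foldl (fun st t => splitStep st t) ([], false, false, [])).2.2.1 then [Tok.A] else [])) :=
    (rawAppend tokE).comp (hbef.pair (ite (hpend.and hfound.not) (const _ [Tok.A]) (const _ [])))
  exact (hfound.pair (hflush.pair haft)).congr fun l => rfl

end STA

end Literature.Computability.ImplicitComplexity
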